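import Literature.Probability.Percolation.LongRangeKernelPercolationProofs
import Literature.Probability.Percolation.ClusterBoundary
import Literature.Probability.LatticeModels.ProdBernoulliBK
import HarnessLib

/-!
# Sharpness for long-range percolation, I: finite susceptibility from `φ_β(S) < 1`

Topic `Literature/Probability/Percolation`. First part of the proof of sharpness of the phase
transition for long-range percolation with a kernel `J` on `ℤ^d` (`kernelPercolation J β`,
Hutchcroft's setting) along Duminil-Copin–Tassion, *Comm. Math. Phys.* 343 (2016), §1, whose
setting is exactly this one ("for `x, y ∈ V`, `{x,y}` is open with probability
`1 - e^{-βJ_{x,y}}`"; Thm. 1.1: "For `β < β_c`, the susceptibility is finite"). Sharpness —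
`E_β|K(0)| < ∞` for `β < β_c` — is the input "[duminil2015new, 1901.10363, aizenman1987sharpness]"
of Hutchcroft 2022, Prop. 2.4 and Prop. 2.7.

This file proves the BK half of the argument (DCT16 §1.4), entirely in infinite volume:

* `Walk.exists_exit_decomposition`, `openConn_subset_iUnion_exit` — first exit of a
  self-avoiding open path from `S`: `{z ↔ x} ⊆ ⋃_{y ∈ S, w ∉ S} {z ↔ y in S} □ {yw open} □ {w ↔ x}`;
* `prodBernoulli_openConn_le_sum_exit` — **DCT16 Lemma 1.5** (with `A = V`, `B = {x}`):
  `P(z ↔ x) ≤ Σ_{y ∈ S} Σ_{w ∉ S} P(z ↔ y in S) p_{yw} P(w ↔ x)` for every product Bernoulli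
  measure on the edges (BK inequality for finitary increasing events,
  `prodBernoulli_bk_list`);
* `kernelPhi J β S` — DCT's `φ_β(S) = Σ_{x ∈ S} Σ_{y ∉ S} (1 - e^{-βJ_{x,y}}) ℙ_β(0 ↔ x in S)`
  ((1.1)), its nonnegativity, monotonicity in `β`, and the summability of the exit weights;
* `kernelPercolation_sum_real_openConn_le` — **DCT16 §1.4 (item 2)**: if `φ_β(S) < 1` for a
  finite `S ∋ 0` then `Σ_{x ∈ Λ} ℙ_β(z ↔ x) ≤ |S|/(1 - φ_β(S))` for every finite `Λ` and every
  `z` ("`χ(Λ, β) ≤ |S|/(1 - φ_β(S))`", optimising over translates), i.e.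
  `E_β|K(0)| ≤ |S|/(1 - φ_β(S)) < ∞`.

The differential-inequality half (DCT16 Lemma 1.4) and the assembly `β < β_c ⇒ E_β|K(0)| < ∞`
are in the sequel files.

## References

* [DuminilCopinTassionCMP2016] H. Duminil-Copin, V. Tassion, *A new proof of the sharpness of
  the phase transition for Bernoulli percolation and the Ising model*, Comm. Math. Phys. 343
  (2016) 725–745, arXiv:1502.03050: §1.1 (setting, Thm. 1.1, (1.1)), Lemma 1.5, §1.4.
* [AizenmanBarsky1987] M. Aizenman, D. J. Barsky, *Sharpness of the phase transition in
  percolation models*, Comm. Math. Phys. 108 (1987) 489–526.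
* [Hutchcroft2022] T. Hutchcroft, J. Math. Phys. 63 (2022), arXiv:2202.07634, Prop. 2.4 / 2.7
  (where sharpness is used).
-/

noncomputable section

namespace Literature.Probability.Percolation

open MeasureTheory Finset Literature.Probability.LatticeModels
open scoped ENNReal

variable {V : Type*}

/-! ### First exit of an open path from a set -/

/-- **First-exit decomposition of a walk**: a walk from a vertex of `S` to a vertex outside `S`
splits as a walk inside `S`, an edge leaving `S`, and a final walk, the edge lists adding up.
[folklore] -/
theorem Walk.exists_exit_decomposition {G : SimpleGraph V} (S : Set V) :
    ∀ {a b : V} (p : G.Walk a b), a ∈ S → b ∉ S →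
      ∃ (y w : V) (p₁ : G.Walk a y) (p₂ : G.Walk w b), G.Adj y w ∧
        (∀ v ∈ p₁.support, v ∈ S) ∧ w ∉ S ∧ p.edges = p₁.edges ++ s(y, w) :: p₂.edges
  | _, _, SimpleGraph.Walk.nil, ha, hb => absurd ha hb
  | a, b, SimpleGraph.Walk.cons (v := a') hadj p, ha, hb => by
    by_cases ha' : a' ∈ S
    · obtain ⟨y, w, p₁, p₂, hyw, hS, hw, hedges⟩ := Walk.exists_exit_decomposition S p ha' hb
      refine ⟨y, w, SimpleGraph.Walk.cons hadj p₁, p₂, hyw, ?_, hw, ?_⟩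
      · intro v hv
        rw [SimpleGraph.Walk.support_cons, List.mem_cons] at hv
        rcases hv with rfl | hv
        · exact ha
        · exact hS v hv
      · rw [SimpleGraph.Walk.edges_cons, SimpleGraph.Walk.edges_cons, hedges]; rfl
    · exact ⟨a, a', SimpleGraph.Walk.nil, p, hadj, by simpa using ha, ha', by simp⟩

/-- **The exit inequality, event form** (Duminil-Copin–Tassion 2016, proof of Lemma 1.5: "one can
define the first `k` such that `v_{k+1} ∉ S` … the following events occur disjointly"): if
`z ∈ S` and `x ∉ S` then
`{z ↔ x} ⊆ ⋃_{y ∈ S, w ∉ S} {z ↔ y in S} □ {yw open} □ {w ↔ x}` — split a self-avoiding open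
path at its first edge leaving `S`. [cite: DuminilCopinTassionCMP2016, Lemma 1.5 (proof)] -/
theorem openConn_subset_iUnion_exit [DecidableEq V] (S : Set V) {z x : V} (hz : z ∈ S)
    (hx : x ∉ S) :
    (openConn z x : Set (BondConfig V)) ⊆ ⋃ (y : V) (w : V), {ω | y ∈ S ∧ w ∉ S ∧
      ω ∈ disjointOccurrenceList [openConnIn S z y, {ω | s(y, w) ∈ ω}, openConn w x]} := by
  intro ω hω
  obtain ⟨p, hp⟩ := SimpleGraph.Reachable.exists_isPath (hω : (openGraph ω).Reachable z x)
  obtain ⟨y, w, p₁, p₂, hyw, hS, hw, hedges⟩ := Walk.exists_exit_decomposition S p hz hx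
  have hnd : (p₁.edges ++ s(y, w) :: p₂.edges).Nodup := hedges ▸ hp.edges_nodup
  refine Set.mem_iUnion.2 ⟨y, Set.mem_iUnion.2 ⟨w, hS y p₁.end_mem_support, hw, ?_⟩⟩
  -- the three disjoint open witnesses
  have key := mem_disjointOccurrenceList_of_pairwise_disjoint
    [((openConnIn S z y : Set (BondConfig V)), {e | e ∈ p₁.edges}),
      ({ω : BondConfig V | s(y, w) ∈ ω}, {s(y, w)}),
      ((openConn w x : Set (BondConfig V)), {e | e ∈ p₂.edges})]
    (by
      intro q hq
      simp only [List.mem_cons, List.not_mem_nil, or_false] at hq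
      rcases hq with rfl | rfl | rfl
      · exact isUpperSet_openConnIn S z y
      · exact fun ω ω' h he => h he
      · exact isUpperSet_openConn w x)
    (by
      intro q hq
      simp only [List.mem_cons, List.not_mem_nil, or_false] at hq
      rcases hq with rfl | rfl | rfl
      · exact mem_openConnIn_of_walk p₁ hS fun e he => he
      · exact Set.mem_singleton _
      · exact reachable_openGraph_of_walk p₂ fun e he => he)
    (by
      rw [List.nodup_append] at hnd
      obtain ⟨h1, h23, h123⟩ := hnd
      rw [List.nodup_cons] at h23
      simp only [List.pairwise_cons, List.mem_cons, List.not_mem_nil, or_false, forall_eq_or_imp,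
        forall_eq, List.Pairwise.nil, and_true]
      refine ⟨⟨?_, ?_⟩, ?_, ?_⟩
      · rw [Set.disjoint_singleton_right]
        exact fun h => h123 _ h _ (by simp) rfl
      · refine Set.disjoint_left.2 fun e he he' => h123 e he e ?_ rfl
        simp only [Set.mem_setOf_eq] at he'
        exact List.mem_cons_of_mem _ he'
      · rw [Set.disjoint_singleton_left]
        exact h23.1
      · intro q hq; exact hq.elim)
    (ω := ω) (by
      intro q hq
      simp only [List.mem_cons, List.not_mem_nil, or_false] at hq
      rcases hq with rfl | rfl | rfl
      · exact fun e he => mem_of_mem_walk_edges p (by rw [hedges]; exact List.mem_append_left _ he)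
      · intro e he
        rw [Set.mem_singleton_iff] at he
        subst he
        exact mem_of_mem_walk_edges p (by rw [hedges]; simp)
      · intro e he
        simp only [Set.mem_setOf_eq] at he
        exact mem_of_mem_walk_edges p (by rw [hedges]; simp [he]))
  simpa using key

/-! ### The exit inequality for product Bernoulli measures -/

/-- `{e open}` is finitary (private copy of the lemma of `BoundaryFunctionalBound.lean`).
[folklore] -/
private theorem isFinitary_setOf_mem' (e : Sym2 V) : IsFinitary {ω : BondConfig V | e ∈ ω} :=
  fun _ hω => ⟨{e}, by simpa using hω, by simp⟩

/-- **The exit inequality** (Duminil-Copin–Tassion 2016, Lemma 1.5 with `A = V`, `B = {x}`: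
"`ℙ_β[u ↔ B in A] ≤ Σ_{x ∈ S} Σ_{y ∉ S} (1 - e^{-βJ_{x,y}}) ℙ_β[u ↔ x in S] ℙ_β[y ↔ B in A]`",
"a direct consequence of the BK inequality applied twice"): for `z ∈ S`, `x ∉ S` and any product
Bernoulli measure on the edges, `P(z ↔ x) ≤ Σ_{y ∈ S} Σ_{w ∉ S} P(z ↔ y in S) p_{yw} P(w ↔ x)`.
[cite: DuminilCopinTassionCMP2016, Lemma 1.5] -/
theorem prodBernoulli_openConn_le_sum_exit [DecidableEq V] [Countable V]
    (p : Sym2 V → unitInterval) (S : Finset V) {z x : V} (hz : z ∈ S) (hx : x ∉ S) :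
    prodBernoulli p (openConn z x) ≤
      ∑ y ∈ S, ∑' w : V, if w ∈ S then 0 else
        prodBernoulli p (openConnIn ↑S z y) * ENNReal.ofReal (p s(y, w)) *
          prodBernoulli p (openConn w x) := by
  classical
  set μ := prodBernoulli p with hμ
  -- the events of the decomposition
  set E : V → V → Set (BondConfig V) := fun y w => {ω | y ∈ (↑S : Set V) ∧ w ∉ (↑S : Set V) ∧
    ω ∈ disjointOccurrenceList [openConnIn ↑S z y, {ω | s(y, w) ∈ ω}, openConn w x]} with hE
  have hsub : (openConn z x : Set (BondConfig V)) ⊆ ⋃ y ∈ S, ⋃ w : V, E y w := by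
    intro ω hω
    have := openConn_subset_iUnion_exit (↑S : Set V) (Finset.mem_coe.2 hz)
      (by simpa using hx) hω
    simp only [Set.mem_iUnion] at this
    obtain ⟨y, w, hyw⟩ := this
    exact Set.mem_biUnion (Finset.mem_coe.1 hyw.1) (Set.mem_iUnion.2 ⟨w, hyw⟩)
  refine le_trans (measure_mono hsub) (le_trans (measure_biUnion_finset_le _ _) ?_)
  refine Finset.sum_le_sum fun y hy => le_trans (measure_iUnion_le _) (ENNReal.tsum_le_tsum fun w => ?_)
  by_cases hw : w ∈ S
  · have : E y w = ∅ := Set.eq_empty_of_forall_notMem fun ω hω => hω.2.1 (Finset.mem_coe.2 hw)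
    simp [this, hw]
  · rw [if_neg hw]
    have hEsub : E y w ⊆ disjointOccurrenceList
        [openConnIn ↑S z y, {ω : BondConfig V | s(y, w) ∈ ω}, openConn w x] := fun ω hω => hω.2.2
    refine le_trans (measure_mono hEsub) ?_
    -- BK for the three finitary increasing events
    have hbk := prodBernoulli_bk_list p
      [openConnIn ↑S z y, {ω : BondConfig V | s(y, w) ∈ ω}, openConn w x]
      (by
        intro A hA
        simp only [List.mem_cons, List.not_mem_nil, or_false] at hA
        rcases hA with rfl | rfl | rfl
        · exact isUpperSet_openConnIn _ z y
        · exact fun ω ω' h he => h he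
        · exact isUpperSet_openConn w x)
      (by
        intro A hA
        simp only [List.mem_cons, List.not_mem_nil, or_false] at hA
        rcases hA with rfl | rfl | rfl
        · exact isFinitary_openConnIn _ z y
        · exact isFinitary_setOf_mem' _
        · exact isFinitary_openConn w x)
    simp only [List.map_cons, List.map_nil, List.prod_cons, List.prod_nil, mul_one] at hbk
    have hp : ((p s(y, w) : unitInterval) : ℝ) = μ.real {ω | s(y, w) ∈ ω} := by
      rw [hμ, prodBernoulli_real_setOf_mem]
    rw [← ofReal_measureReal (measure_ne_top μ _), ← ofReal_measureReal (measure_ne_top μ _),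
      ← ofReal_measureReal (measure_ne_top μ (openConn w x)), hp,
      ← ENNReal.ofReal_mul measureReal_nonneg, ← ENNReal.ofReal_mul (by positivity)]
    refine ENNReal.ofReal_le_ofReal ?_
    simpa [mul_assoc] using hbk

/-! ### Finite susceptibility for the long-range model from `φ_β(S) < 1` -/

variable {d : ℕ}

/-- **`φ_β(S)`** (Duminil-Copin–Tassion 2016, (1.1): "`φ_β(S) := Σ_{x ∈ S} Σ_{y ∉ S}
(1 - e^{-βJ_{x,y}}) ℙ_β(0 ↔ x in S)`"), for the long-range model `ℙ_{β,J}` on `ℤ^d`.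
[cite: DuminilCopinTassionCMP2016, §1.1 (1.1)] -/
def kernelPhi (J : Sym2 (Site d) → ℝ) (β : ℝ) (S : Finset (Site d)) : ℝ :=
  ∑ y ∈ S, (∑' w : Site d, if w ∈ S then 0 else (kernelEdgeProb J β s(y, w) : ℝ)) *
    (kernelPercolation J β).real (openConnIn ↑S 0 y)

/-- The exit probabilities `w ↦ p_{yw} 𝟙[w ∉ S]` are summable for an integrable kernel
(`1 - e^{-t} ≤ t`). [cite: Hutchcroft2022, §1 (p. 3, integrable kernels)] -/
theorem summable_kernelEdgeProb_exit {J : Sym2 (Site d) → ℝ} (hJ : ∀ e, 0 ≤ J e)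
    (hI : IsIntegrableKernel J) {β : ℝ} (hβ : 0 ≤ β) (S : Finset (Site d)) (y : Site d) :
    Summable fun w : Site d => if w ∈ S then (0 : ℝ) else (kernelEdgeProb J β s(y, w) : ℝ) := by
  refine Summable.of_nonneg_of_le (fun w => ?_) (fun w => ?_) ((hI y).mul_left β)
  · split_ifs
    · exact le_rfl
    · exact (kernelEdgeProb J β s(y, w)).2.1
  · split_ifs
    · exact mul_nonneg hβ (hJ _)
    · rw [coe_kernelEdgeProb (mul_nonneg hβ (hJ _))]
      have := Real.add_one_le_exp (-(β * J s(y, w)))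
      linarith

/-- `0 ≤ φ_β(S)`. [folklore] -/
theorem kernelPhi_nonneg {J : Sym2 (Site d) → ℝ} (β : ℝ) (S : Finset (Site d)) :
    0 ≤ kernelPhi J β S :=
  Finset.sum_nonneg fun y _ => mul_nonneg
    (tsum_nonneg fun w => by split_ifs; exacts [le_rfl, (kernelEdgeProb J β s(y, w)).2.1])
    measureReal_nonneg

/-- **Finite susceptibility from `φ_β(S) < 1`** (Duminil-Copin–Tassion 2016, Thm. 1.1, item 2 and
§1.4; Aizenman–Barsky 1987 for long-range models on `ℤ^d`). For a nonnegative, translation-invariant, integrable kernel,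
`β ≥ 0` and a finite `S ∋ 0` with `φ_β(S) < 1`: for every finite `Λ` and every vertex `z`,
`Σ_{x ∈ Λ} ℙ_β(z ↔ x) ≤ |S| / (1 - φ_β(S))`; in particular `E_β|K(0)| ≤ |S|/(1 - φ_β(S)) < ∞`.
Proof as printed ("`Σ_{v ∈ Λ} ℙ_β[u ↔ v] ≤ |S| + φ_β(S) χ(Λ,β)` … Optimizing over `u`, we deduce
that `χ(Λ,β) ≤ |S|/(1 - φ_β(S))`"), with the translates realised through translation invariance
of the two-point function: `M := sup_v Σ_{x ∈ Λ} ℙ_β(0 ↔ x + v) ≤ |S| + φ_β(S) M`, `M ≤ |Λ| < ∞`.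
[cite: DuminilCopinTassionCMP2016, §1.4 (proof of Thm. 1.1, item 2)] -/
theorem kernelPercolation_sum_real_openConn_le {J : Sym2 (Site d) → ℝ} (hJ : ∀ e, 0 ≤ J e)
    (hT : IsTranslationInvariantKernel J) (hI : IsIntegrableKernel J) {β : ℝ} (hβ : 0 ≤ β)
    {S : Finset (Site d)} (h0 : (0 : Site d) ∈ S) (hφ : kernelPhi J β S < 1)
    (Λ : Finset (Site d)) (z : Site d) :
    ∑ x ∈ Λ, (kernelPercolation J β).real (openConn z x) ≤ S.card / (1 - kernelPhi J β S) := by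
  classical
  set μ := kernelPercolation J β with hμ
  -- the translated susceptibilities and their supremum
  set χ : Site d → ℝ≥0∞ := fun v => ∑ x ∈ Λ, μ (openConn 0 (x + v)) with hχ
  have hχle : ∀ v, χ v ≤ Λ.card := by
    intro v
    calc χ v ≤ ∑ x ∈ Λ, (1 : ℝ≥0∞) := Finset.sum_le_sum fun x _ => prob_le_one
      _ = Λ.card := by simp
  set M : ℝ≥0∞ := ⨆ v, χ v with hM
  have hMle : M ≤ Λ.card := iSup_le hχle
  have hMtop : M ≠ ∞ := ne_top_of_le_ne_top (ENNReal.natCast_ne_top _) hMle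
  have hχM : ∀ v, χ v ≤ M := fun v => le_iSup χ v
  -- translation invariance of the two-point function
  have htwo : ∀ a b : Site d, μ (openConn a b) = μ (openConn 0 (b - a)) := by
    intro a b
    have h := kernelPercolation_real_openConn_add hT β 0 (b - a) a
    rw [zero_add, sub_add_cancel] at h
    rw [← ofReal_measureReal (measure_ne_top _ _), ← ofReal_measureReal (measure_ne_top _ _)]
    rw [hμ, h]
  -- `φ` in `ℝ≥0∞`
  set φE : ℝ≥0∞ := ∑ y ∈ S, ∑' w : Site d, if w ∈ S then 0 else
    μ (openConnIn ↑S 0 y) * ENNReal.ofReal (kernelEdgeProb J β s(y, w) : ℝ) with hφE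
  have hφE_eq : φE = ENNReal.ofReal (kernelPhi J β S) := by
    have hnn : ∀ y w : Site d, 0 ≤ (if w ∈ S then (0 : ℝ) else (kernelEdgeProb J β s(y, w) : ℝ)) :=
      fun y w => by split_ifs; exacts [le_rfl, (kernelEdgeProb J β s(y, w)).2.1]
    have hterm : ∀ y ∈ S, (∑' w : Site d, if w ∈ S then (0 : ℝ≥0∞) else
        μ (openConnIn ↑S 0 y) * ENNReal.ofReal (kernelEdgeProb J β s(y, w) : ℝ)) =
        ENNReal.ofReal ((∑' w : Site d, if w ∈ S then (0 : ℝ) else (kernelEdgeProb J β s(y, w) : ℝ)) *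
          μ.real (openConnIn ↑S 0 y)) := by
      intro y _
      rw [ENNReal.ofReal_mul (tsum_nonneg (hnn y)),
        ENNReal.ofReal_tsum_of_nonneg (hnn y) (summable_kernelEdgeProb_exit hJ hI hβ S y),
        ofReal_measureReal (measure_ne_top _ _), ← ENNReal.tsum_mul_right]
      refine tsum_congr fun w => ?_
      by_cases hw : w ∈ S
      · simp [hw]
      · rw [if_neg hw, if_neg hw, mul_comm]
    rw [kernelPhi, ENNReal.ofReal_sum_of_nonneg (fun y _ => mul_nonneg (tsum_nonneg (hnn y))
      measureReal_nonneg)]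
    exact Finset.sum_congr rfl hterm
  -- the key inequality `χ v ≤ |S| + φ M` for every translate
  have hkey : ∀ v, χ v ≤ S.card + φE * M := by
    intro v
    -- split `Λ` according to whether `x + v ∈ S`
    have hsplit : χ v = ∑ x ∈ Λ.filter (fun x => x + v ∈ S), μ (openConn 0 (x + v)) +
        ∑ x ∈ Λ.filter (fun x => x + v ∉ S), μ (openConn 0 (x + v)) := by
      rw [hχ]; exact (Finset.sum_filter_add_sum_filter_not Λ (fun x => x + v ∈ S) _).symm
    rw [hsplit]
    refine add_le_add ?_ ?_
    · calc ∑ x ∈ Λ.filter (fun x => x + v ∈ S), μ (openConn 0 (x + v))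
          ≤ ∑ x ∈ Λ.filter (fun x => x + v ∈ S), (1 : ℝ≥0∞) := Finset.sum_le_sum fun _ _ => prob_le_one
        _ = (Λ.filter (fun x => x + v ∈ S)).card := by simp
        _ ≤ S.card := by
          exact_mod_cast Finset.card_le_card_of_injOn (fun x => x + v)
            (fun x hx => (Finset.mem_filter.1 hx).2) (fun a _ b _ h => add_right_cancel h)
    · -- the exit inequality for each `x + v ∉ S`, then exchange the sums
      calc ∑ x ∈ Λ.filter (fun x => x + v ∉ S), μ (openConn 0 (x + v))
          ≤ ∑ x ∈ Λ.filter (fun x => x + v ∉ S), ∑ y ∈ S, ∑' w : Site d, if w ∈ S then 0 else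
              μ (openConnIn ↑S 0 y) * ENNReal.ofReal (kernelEdgeProb J β s(y, w) : ℝ) *
                μ (openConn w (x + v)) :=
            Finset.sum_le_sum fun x hx =>
              prodBernoulli_openConn_le_sum_exit _ S h0 (Finset.mem_filter.1 hx).2
        _ ≤ ∑ x ∈ Λ, ∑ y ∈ S, ∑' w : Site d, if w ∈ S then 0 else
              μ (openConnIn ↑S 0 y) * ENNReal.ofReal (kernelEdgeProb J β s(y, w) : ℝ) *
                μ (openConn w (x + v)) :=
            Finset.sum_le_sum_of_subset_of_nonneg (Finset.filter_subset _ _) fun _ _ _ => bot_le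
        _ = ∑ y ∈ S, ∑' w : Site d, ∑ x ∈ Λ, (if w ∈ S then 0 else
              μ (openConnIn ↑S 0 y) * ENNReal.ofReal (kernelEdgeProb J β s(y, w) : ℝ) *
                μ (openConn w (x + v))) := by
            rw [Finset.sum_comm]
            refine Finset.sum_congr rfl fun y _ => ?_
            exact (Summable.tsum_finsetSum fun _ _ => ENNReal.summable).symm
        _ ≤ ∑ y ∈ S, ∑' w : Site d, (if w ∈ S then 0 else
              μ (openConnIn ↑S 0 y) * ENNReal.ofReal (kernelEdgeProb J β s(y, w) : ℝ)) * M := by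
            refine Finset.sum_le_sum fun y _ => ENNReal.tsum_le_tsum fun w => ?_
            by_cases hw : w ∈ S
            · simp [hw]
            · simp only [if_neg hw, ← Finset.mul_sum]
              refine mul_le_mul_right ?_ _
              calc ∑ x ∈ Λ, μ (openConn w (x + v)) = χ (v - w) := by
                    rw [hχ]
                    refine Finset.sum_congr rfl fun x _ => ?_
                    rw [htwo w (x + v)]; congr 2; try abel
                _ ≤ M := hχM _
        _ = φE * M := by
            rw [hφE, Finset.sum_mul]
            refine Finset.sum_congr rfl fun y _ => ?_
            rw [← ENNReal.tsum_mul_right]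
  -- hence `M ≤ |S| + φ M`
  have hMkey : M ≤ S.card + φE * M := iSup_le hkey
  -- pass to real numbers
  have hφlt : φE < 1 := by rw [hφE_eq]; exact ENNReal.ofReal_lt_one.2 hφ
  have hφtop : φE ≠ ∞ := ne_top_of_lt hφlt
  have hreal : M.toReal ≤ S.card + kernelPhi J β S * M.toReal := by
    have := ENNReal.toReal_mono (by
      refine ENNReal.add_ne_top.2 ⟨ENNReal.natCast_ne_top _, ENNReal.mul_ne_top hφtop hMtop⟩) hMkey
    rw [ENNReal.toReal_add (ENNReal.natCast_ne_top _) (ENNReal.mul_ne_top hφtop hMtop),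
      ENNReal.toReal_mul, hφE_eq, ENNReal.toReal_ofReal (kernelPhi_nonneg β S),
      ENNReal.toReal_natCast] at this
    exact this
  have hMbound : M.toReal ≤ S.card / (1 - kernelPhi J β S) := by
    rw [le_div_iff₀ (by linarith)]
    nlinarith [ENNReal.toReal_nonneg (a := M)]
  -- finally, the susceptibility from `z` is a translate
  calc ∑ x ∈ Λ, μ.real (openConn z x) = (χ (-z)).toReal := by
        rw [hχ, ENNReal.toReal_sum fun x _ => measure_ne_top _ _]
        refine Finset.sum_congr rfl fun x _ => ?_
        rw [measureReal_def, htwo z x]; congr 2; try abel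
    _ ≤ M.toReal := ENNReal.toReal_mono hMtop (hχM _)
    _ ≤ S.card / (1 - kernelPhi J β S) := hMbound

/-- **`φ_β(S)` is non-decreasing in `β ≥ 0`** (both the exit probabilities and the restricted
connection probabilities are; "the set … defining `β̃_c` is open", DCT16 §1.2).
[cite: DuminilCopinTassionCMP2016, §1.2 ("Behaviour at β_c")] -/
theorem kernelPhi_mono {J : Sym2 (Site d) → ℝ} (hJ : ∀ e, 0 ≤ J e) (hI : IsIntegrableKernel J)
    {β β' : ℝ} (hβ : 0 ≤ β) (hββ' : β ≤ β') (S : Finset (Site d)) :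
    kernelPhi J β S ≤ kernelPhi J β' S := by
  classical
  unfold kernelPhi
  refine Finset.sum_le_sum fun y _ => mul_le_mul ?_ ?_ measureReal_nonneg ?_
  · refine Summable.tsum_le_tsum (fun w => ?_) (summable_kernelEdgeProb_exit hJ hI hβ S y)
      (summable_kernelEdgeProb_exit hJ hI (hβ.trans hββ') S y)
    split_ifs
    · exact le_rfl
    · exact_mod_cast kernelEdgeProb_mono (hJ _) hββ'
  · exact kernelPercolation_real_mono hJ hββ' (isUpperSet_openConnIn _ _ _)
      ((isFinitary_openConnIn _ _ _).measurableSet (isUpperSet_openConnIn _ _ _))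
  · exact tsum_nonneg fun w => by split_ifs; exacts [le_rfl, (kernelEdgeProb J β' s(y, w)).2.1]

end Literature.Probability.Percolation

end
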